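import Summits.RiemannHypothesis.RiemannHypothesis.Theses.RuelleBand
import Literature.Analysis.UnboundedOperators.DiagonalOperatorCompact

/-!
# The engine outputs rung #4 and nothing more (negative lemma for `AsymptoticCriticalLine` / `BandEngine`)

Refuter work file (cdisprove, cycle 4) supporting crux stmt-RiemannHypothesis-2063
(`RuelleBand.AsymptoticCriticalLine`, rung #4) and informing the support items `BandEngine`
(stmt-2065), `BandRealisation` (2062), `AsymptoticToRealisation` (2067).

DIAGONAL GROUPS. For a sequence of exponents `z : ℕ → ℂ` with `|Re zₙ| ≤ 1` the diagonal
one-parameter group `T t = diag(e^{t zₙ})` on `ℓ²(ℕ, ℂ)` (`diagGroup`) is a group of bounded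
operators (`diagGroup_zero`, `diagGroup_add`) with the basis vectors as joint eigenvectors of
characters `t ↦ e^{t zₙ}` (`diagGroup_basis`). If `Re zₙ → 0` then AT EVERY TIME `t₀` the
operator `T t₀` is unitary + compact: `T t₀ − diag(e^{i t₀ Im zₙ})` is the diagonal operator with
symbol `e^{i t₀ Im zₙ}(e^{t₀ Re zₙ} − 1) → 0` (`isCompactOperator_diagGroup_sub_phase`,
`phaseOp_mem_unitary`).

ENGINE SHARPNESS (`exists_engineModel_infinite_offLine`). With `zₙ = 1/(n+2) + in` the hypotheses
of `BandEngine` hold (at every `t₀ > 0`) while the joint eigenvalues `zₙ` are ALL off the line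
`Re z = 0`, infinitely many, accumulating at it: "unitary modulo compact at one time" yields
exactly the shape of rung #4 (finitely many joint eigenvalues outside every strip `|Re z| < ε`)
and is compatible with the failure of rung #5 (`CofiniteCriticalLine`) and of thesis X — the
operator-side twin of `not_forall_powerSum_imp_finite` (Negative/Ladder). So no strengthening
of the engine's conclusion is available from its hypotheses: #5 and X need an input invisible to
compactness (for Dyatlov–Faure–Guillarmou: self-adjointness of `Δ`, reality of the exceptional
resonances). The same `diagGroup`, fed with an enumeration `ρₙ − 1/2` of the non-trivial zeros,
is the intended witness of `AsymptoticToRealisation` (rung #4 ⟹ `Re(ρₙ − 1/2) → 0` along the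
enumeration ⟹ unitary + compact), which a prover may build on this file.

All statements `sorry`-free; axioms `propext`, `Classical.choice`, `Quot.sound`.
-/

noncomputable section

set_option linter.dupNamespace false

namespace Summit.RiemannHypothesis.RiemannHypothesis.Theorems.AsymptoticCriticalLine.Negative

open Complex Filter Topology

/-- The Hilbert space `ℓ²(ℕ, ℂ)`. [folklore] -/
abbrev Ell2 : Type := lp (fun _ : ℕ => ℂ) 2

/-- Its standard Hilbert basis (the identity representation). [folklore] -/
def stdBasis : HilbertBasis ℕ ℂ Ell2 :=
  HilbertBasis.ofRepr (LinearIsometryEquiv.refl ℂ Ell2)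

/-- `‖e^{t zₙ}‖ ≤ e^{|t|}` when `|Re zₙ| ≤ 1` (exponent sequences with real parts in `[-1, 1]`, so that
`e^{t zₙ}` is bounded for each `t`). [folklore] -/
theorem norm_exp_mul_le {z : ℕ → ℂ} (hz : ∀ n : ℕ, |(z n).re| ≤ 1) (t : ℝ) (n : ℕ) :
    ‖exp (t * z n)‖ ≤ Real.exp |t| := by
  rw [norm_exp, Real.exp_le_exp]
  have h1 : ((t : ℂ) * z n).re = t * (z n).re := by simp
  rw [h1]
  calc t * (z n).re ≤ |t * (z n).re| := le_abs_self _
    _ = |t| * |(z n).re| := abs_mul _ _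
    _ ≤ |t| * 1 := mul_le_mul_of_nonneg_left (hz n) (abs_nonneg _)
    _ = |t| := mul_one _

/-- The bounded symbol `n ↦ e^{t zₙ}`. [folklore] -/
def expSymbol {z : ℕ → ℂ} (hz : ∀ n : ℕ, |(z n).re| ≤ 1) (t : ℝ) : lp (fun _ : ℕ => ℂ) ⊤ :=
  ⟨fun n => exp (t * z n), memℓp_infty ⟨Real.exp |t|, by
    rintro _ ⟨n, rfl⟩
    exact norm_exp_mul_le hz t n⟩⟩

/-- [folklore] -/
@[simp] theorem expSymbol_apply {z : ℕ → ℂ} (hz : ∀ n : ℕ, |(z n).re| ≤ 1) (t : ℝ) (n : ℕ) :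
    expSymbol hz t n = exp (t * z n) := rfl

/-- THE DIAGONAL GROUP `T t = diag(e^{t zₙ})` on `ℓ²(ℕ, ℂ)`. [folklore] -/
def diagGroup {z : ℕ → ℂ} (hz : ∀ n : ℕ, |(z n).re| ≤ 1) (t : ℝ) : Ell2 →L[ℂ] Ell2 :=
  stdBasis.diagonalCLM (expSymbol hz t)

/-- `T 0 = id`. [folklore] -/
theorem diagGroup_zero {z : ℕ → ℂ} (hz : ∀ n : ℕ, |(z n).re| ≤ 1) :
    diagGroup hz 0 = ContinuousLinearMap.id ℂ Ell2 := by
  have h : expSymbol hz 0 = 1 := by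
    apply lp.ext
    funext n
    rw [lp.infty_coeFn_one, expSymbol_apply]
    simp
  rw [diagGroup, h, HilbertBasis.diagonalCLM_one]
  rfl

/-- The group law `T (s + t) = T s ∘ T t`. [folklore] -/
theorem diagGroup_add {z : ℕ → ℂ} (hz : ∀ n : ℕ, |(z n).re| ≤ 1) (s t : ℝ) :
    diagGroup hz (s + t) = (diagGroup hz s).comp (diagGroup hz t) := by
  have h : expSymbol hz (s + t) = expSymbol hz s * expSymbol hz t := by
    apply lp.ext
    funext n
    rw [lp.infty_coeFn_mul, Pi.mul_apply, expSymbol_apply, expSymbol_apply, expSymbol_apply,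
      ← exp_add]
    push_cast
    ring_nf
  rw [diagGroup, h, HilbertBasis.diagonalCLM_mul]
  rfl

/-- [folklore] -/
theorem stdBasis_ne_zero (n : ℕ) : (stdBasis n : Ell2) ≠ 0 :=
  stdBasis.orthonormal.ne_zero n

/-- JOINT EIGENVECTORS: `T t eₙ = e^{t zₙ} eₙ` for all `t`. [folklore] -/
theorem diagGroup_basis {z : ℕ → ℂ} (hz : ∀ n : ℕ, |(z n).re| ≤ 1) (t : ℝ) (n : ℕ) :
    diagGroup hz t (stdBasis n) = exp (t * z n) • stdBasis n := by
  rw [diagGroup, HilbertBasis.diagonalCLM_basis, expSymbol_apply]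

/-- Every `zₙ` is a joint eigenvalue of the diagonal group. [folklore] -/
theorem range_subset_jointEigenvalues {z : ℕ → ℂ} (hz : ∀ n : ℕ, |(z n).re| ≤ 1) :
    Set.range z ⊆ {w : ℂ | ∃ v : Ell2, v ≠ 0 ∧ ∀ t : ℝ, diagGroup hz t v = exp (↑t * w) • v} := by
  rintro _ ⟨n, rfl⟩
  exact ⟨stdBasis n, stdBasis_ne_zero n, fun t => diagGroup_basis hz t n⟩

/-! ## Unitary + compact at every time when `Re zₙ → 0` -/

/-- The unit-modulus symbol `n ↦ e^{i t Im zₙ}`. [folklore] -/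
def phaseSymbol (z : ℕ → ℂ) (t : ℝ) : lp (fun _ : ℕ => ℂ) ⊤ :=
  ⟨fun n => exp ((t * (z n).im : ℝ) * I), memℓp_infty ⟨1, by
    rintro _ ⟨n, rfl⟩
    simp only [norm_exp_ofReal_mul_I, le_refl]⟩⟩

/-- [folklore] -/
@[simp] theorem phaseSymbol_apply (z : ℕ → ℂ) (t : ℝ) (n : ℕ) :
    phaseSymbol z t n = exp ((t * (z n).im : ℝ) * I) := rfl

/-- The diagonal unitary `U_t = diag(e^{i t Im zₙ})`. [folklore] -/
def phaseOp (z : ℕ → ℂ) (t : ℝ) : Ell2 →L[ℂ] Ell2 :=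
  stdBasis.diagonalCLM (phaseSymbol z t)

/-- `star m * m = 1 = m * star m` for a unit-modulus symbol. [folklore] -/
theorem phaseSymbol_star_mul (z : ℕ → ℂ) (t : ℝ) :
    star (phaseSymbol z t) * phaseSymbol z t = 1 ∧ phaseSymbol z t * star (phaseSymbol z t) = 1 := by
  have key : ∀ n : ℕ, (starRingEnd ℂ) (phaseSymbol z t n) * phaseSymbol z t n = 1 := by
    intro n
    rw [phaseSymbol_apply, ← exp_conj, ← exp_add, map_mul, conj_ofReal, conj_I]
    ring_nf
    exact exp_zero
  constructor
  · apply lp.ext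
    funext n
    rw [lp.infty_coeFn_mul, lp.infty_coeFn_one, Pi.mul_apply, Pi.one_apply, lp.star_apply]
    exact key n
  · apply lp.ext
    funext n
    rw [lp.infty_coeFn_mul, lp.infty_coeFn_one, Pi.mul_apply, Pi.one_apply, lp.star_apply,
      mul_comm]
    exact key n

/-- `U_t` is unitary. [folklore] -/
theorem phaseOp_mem_unitary (z : ℕ → ℂ) (t : ℝ) :
    phaseOp z t ∈ unitary (Ell2 →L[ℂ] Ell2) := by
  rw [Unitary.mem_iff, ContinuousLinearMap.star_eq_adjoint, phaseOp,
    HilbertBasis.adjoint_diagonalCLM, ← HilbertBasis.diagonalCLM_mul,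
    ← HilbertBasis.diagonalCLM_mul, (phaseSymbol_star_mul z t).1, (phaseSymbol_star_mul z t).2,
    HilbertBasis.diagonalCLM_one]
  exact ⟨rfl, rfl⟩

/-- `diag` is additive in the symbol (subtraction). [folklore] -/
theorem diagonalCLM_sub {ι 𝕜 H : Type*} [RCLike 𝕜] [NormedAddCommGroup H] [InnerProductSpace 𝕜 H]
    (b : HilbertBasis ι 𝕜 H) (m n : lp (fun _ : ι => 𝕜) ⊤) :
    b.diagonalCLM (m - n) = b.diagonalCLM m - b.diagonalCLM n := by
  ext x
  apply b.repr.injective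
  ext i
  simp [sub_mul]

/-- The symbol of `T t − U_t` is `e^{i t Im zₙ}(e^{t Re zₙ} − 1)`, of modulus
`|e^{t Re zₙ} − 1|`. [folklore] -/
theorem norm_expSymbol_sub_phaseSymbol {z : ℕ → ℂ} (hz : ∀ n : ℕ, |(z n).re| ≤ 1) (t : ℝ) (n : ℕ) :
    ‖(expSymbol hz t - phaseSymbol z t) n‖ = |Real.exp (t * (z n).re) - 1| := by
  rw [lp.coeFn_sub, Pi.sub_apply, expSymbol_apply, phaseSymbol_apply]
  have hsplit : (t : ℂ) * z n = ((t * (z n).re : ℝ) : ℂ) + ((t * (z n).im : ℝ) : ℂ) * I := by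
    conv_lhs => rw [← re_add_im (z n)]
    push_cast
    ring
  rw [hsplit, exp_add, ← sub_one_mul, norm_mul, norm_exp_ofReal_mul_I, mul_one, ← ofReal_exp,
    ← ofReal_one, ← ofReal_sub, norm_real, Real.norm_eq_abs]

/-- UNITARY + COMPACT AT EVERY TIME: if `Re zₙ → 0` then `T t − U_t` is compact for every `t`
(its symbol tends to `0`). [folklore] -/
theorem isCompactOperator_diagGroup_sub_phase {z : ℕ → ℂ} (hz : ∀ n : ℕ, |(z n).re| ≤ 1)
    (h : Tendsto (fun n => (z n).re) atTop (𝓝 0)) (t : ℝ) :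
    IsCompactOperator (diagGroup hz t - phaseOp z t) := by
  rw [diagGroup, phaseOp, ← diagonalCLM_sub]
  apply stdBasis.isCompactOperator_diagonalCLM_of_tendsto_zero
  rw [Nat.cofinite_eq_atTop]
  have h1 : Tendsto (fun n => Real.exp (t * (z n).re) - 1) atTop (𝓝 0) := by
    have := ((Real.continuous_exp.tendsto _).comp (h.const_mul t))
    rw [mul_zero, Real.exp_zero] at this
    simpa using this.sub_const 1
  have h2 : Tendsto (fun n => |Real.exp (t * (z n).re) - 1|) atTop (𝓝 0) := by
    simpa using h1.abs
  refine h2.congr fun n => ?_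
  rw [norm_expSymbol_sub_phaseSymbol]

/-! ## The model: joint eigenvalues `zₙ = 1/(n+2) + in`, all off the line -/

/-- The exponents of the model. [folklore] -/
def modelExp (n : ℕ) : ℂ :=
  ((1 / ((n : ℝ) + 2) : ℝ) : ℂ) + n * I

/-- [folklore] -/
theorem modelExp_re (n : ℕ) : (modelExp n).re = 1 / ((n : ℝ) + 2) := by
  simp only [modelExp, add_re, ofReal_re, mul_re, natCast_re, I_re, mul_zero, natCast_im, I_im,
    mul_one, sub_self, add_zero]

/-- [folklore] -/
theorem modelExp_im (n : ℕ) : (modelExp n).im = n := by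
  simp only [modelExp, add_im, ofReal_im, mul_im, natCast_re, I_im, mul_one, natCast_im, I_re,
    mul_zero, add_zero, zero_add]

/-- [folklore] -/
theorem modelExp_bddRe : ∀ n : ℕ, |(modelExp n).re| ≤ 1 := by
  intro n
  rw [modelExp_re, abs_of_pos (by positivity)]
  rw [div_le_one (by positivity)]
  have : (0 : ℝ) ≤ n := n.cast_nonneg
  linarith

/-- [folklore] -/
theorem modelExp_re_pos (n : ℕ) : 0 < (modelExp n).re := by
  rw [modelExp_re]; positivity

/-- The real parts tend to `0`: the joint eigenvalues ACCUMULATE AT THE LINE from off it. [folklore] -/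
theorem tendsto_modelExp_re : Tendsto (fun n => (modelExp n).re) atTop (𝓝 0) := by
  simp only [modelExp_re]
  have h : Tendsto (fun n : ℕ => (n : ℝ) + 2) atTop atTop :=
    tendsto_atTop_add_const_right _ _ tendsto_natCast_atTop_atTop
  exact tendsto_const_nhds.div_atTop h

/-- [folklore] -/
theorem modelExp_injective : Function.Injective modelExp := by
  intro a b hab
  have h := congrArg Complex.im hab
  rw [modelExp_im, modelExp_im] at h
  exact_mod_cast h

/-- ENGINE SHARPNESS. A complex Hilbert space with a one-parameter group of bounded operators that
is unitary + compact at EVERY time `t₀ > 0` (in particular the hypotheses of `BandEngine` hold),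
whose off-line joint eigenvalues (`Re z ≠ 0`) are nevertheless INFINITELY MANY (and accumulate
at the line `Re z = 0`). The conclusion of `BandEngine` — finitely many joint eigenvalues with
`|Re z| ≥ ε`, for each `ε > 0`: rung #4's shape — therefore cannot be strengthened to rung #5's
shape ("finitely many off-line joint eigenvalues") from the same hypotheses. [folklore] -/
theorem exists_engineModel_infinite_offLine :
    ∃ (H : Type) (_ : NormedAddCommGroup H) (_ : InnerProductSpace ℂ H) (_ : CompleteSpace H)
      (T : ℝ → H →L[ℂ] H),
      T 0 = ContinuousLinearMap.id ℂ H ∧ (∀ s t : ℝ, T (s + t) = (T s).comp (T t)) ∧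
      (∀ t₀ : ℝ, 0 < t₀ → ∃ U : H →L[ℂ] H, U ∈ unitary (H →L[ℂ] H) ∧ IsCompactOperator (T t₀ - U)) ∧
      {z : ℂ | z.re ≠ 0 ∧ ∃ v : H, v ≠ 0 ∧ ∀ t : ℝ, T t v = exp (↑t * z) • v}.Infinite := by
  refine ⟨Ell2, inferInstance, inferInstance, inferInstance, diagGroup modelExp_bddRe,
    diagGroup_zero _, diagGroup_add _, fun t₀ _ => ⟨phaseOp modelExp t₀, phaseOp_mem_unitary _ _,
      isCompactOperator_diagGroup_sub_phase _ tendsto_modelExp_re t₀⟩, ?_⟩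
  have hsub : Set.range modelExp ⊆
      {z : ℂ | z.re ≠ 0 ∧ ∃ v : Ell2, v ≠ 0 ∧ ∀ t : ℝ, diagGroup modelExp_bddRe t v = exp (↑t * z) • v} := by
    rintro w hw
    obtain ⟨n, rfl⟩ := hw
    exact ⟨(modelExp_re_pos n).ne', range_subset_jointEigenvalues modelExp_bddRe ⟨n, rfl⟩⟩
  exact (Set.infinite_range_of_injective modelExp_injective).mono hsub

/-- The same model in the shape of `BandEngine`'s third hypothesis (∃ t₀ > 0 …). [folklore] -/
theorem exists_engineModel_infinite_offLine' :
    ∃ (H : Type) (_ : NormedAddCommGroup H) (_ : InnerProductSpace ℂ H) (_ : CompleteSpace H)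
      (T : ℝ → H →L[ℂ] H),
      T 0 = ContinuousLinearMap.id ℂ H ∧ (∀ s t : ℝ, T (s + t) = (T s).comp (T t)) ∧
      (∃ t₀ : ℝ, 0 < t₀ ∧ ∃ U : H →L[ℂ] H, U ∈ unitary (H →L[ℂ] H) ∧ IsCompactOperator (T t₀ - U)) ∧
      {z : ℂ | z.re ≠ 0 ∧ ∃ v : H, v ≠ 0 ∧ ∀ t : ℝ, T t v = exp (↑t * z) • v}.Infinite := by
  obtain ⟨H, i1, i2, i3, T, h0, hadd, hUK, hinf⟩ := exists_engineModel_infinite_offLine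
  exact ⟨H, i1, i2, i3, T, h0, hadd, ⟨1, one_pos, hUK 1 one_pos⟩, hinf⟩

end Summit.RiemannHypothesis.RiemannHypothesis.Theorems.AsymptoticCriticalLine.Negative
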